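import Literature.MathematicalPhysics.QuantumLattice.HubbardUVSymbolFrameDifferences
import Literature.MathematicalPhysics.QuantumLattice.HubbardUVSymbolCTDifferences
import Literature.MathematicalPhysics.QuantumLattice.MatsubaraShiftedEnvelopeSums
import HarnessLib

/-!
# The padded ultraviolet symbol of the counterterm carrier in TWO FRAMES `K, K′` on the space–time dual torus: the difference symbol
# `G_K − G_{K′}`, its second time and space differences, and their `ℓ²` norms — all LINEAR in the band distance `(ε₀, ε₁, ε₂)`

Topic `MathematicalPhysics/QuantumLattice`; the two-frame companion of `HubbardUVSymbolCTDifferences` (cell gate-hubbard-kl, crux K3: the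
symbol-difference bracket of the two-volume pass — the one-shot covariances `C^K_{>Λ} = hubbardCovAboveCT L M β μ 0 K Λ` of ONE scale in the flow
frames `K = K_n^{(L)}`, `K′ = K_n^{(L′)}` of two volumes, or at two consecutive flow frames).  With `G_K = gridSymbol L M N β (uvSymbolCT L M β μ K Λ) σ`
the padded symbol `(βL²)⁻² Ψ_{e_K(q⃗)}(ω̃_{q₀})·[val q₀ < 2M]` (`Ψ = βL²·Ψ₁`), the difference `G_K − G_{K′}` is the padded symbol of the difference
`uvSymbolCT … K Λ − uvSymbolCT … K′ Λ` (`gridSymbol_sub`) and equals `(βL²)⁻²·βL²·(Ψ₁(ω̃, e_K) − Ψ₁(ω̃, e_{K′}))` on the window.  Under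
`UVLineBound μ K D`, `UVLineBound μ K′ D` (both bands `C²` along lattice lines with bounds `D`) and the band-DIFFERENCE datum `hΔ` (along every lattice line
`K − K′ = −(e_K − e_{K′})` is `C²` with value / first / second derivative `≤ ε₀, ε₁, ε₂`; spelled out, no definition), the continuum estimates of
`HubbardUVSymbolFrameDifferences` give, with the all-order envelopes `C_{a,m} = uvMixedConst Λ a m`:

* `norm_gridSymbol_sub_le` (`≤ (βL²)⁻²·βL²·C_{0,1}ε₀/m(ω̃)²`), `norm_gridSymbol_sub_le_edge`;
* time: `fwdDiff_two_time_gridSymbol_sub_eq`, `norm_fwdDiff_two_time_gridSymbol_sub_le_interior` (`(2π/β)²·C_{2,1}ε₀/max(|ω̃|−4π/β,Λ/2)⁴`),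
  `norm_fwdDiff_two_time_gridSymbol_sub_le_edge`, `fwdDiff_two_time_gridSymbol_eq_zero_of_padding'` (any symbol);
* space: `fwdDiff_two_space_gridSymbol_sub_eq`, `norm_fwdDiff_two_space_gridSymbol_sub_le`
  (`(2π/L)²·(C_{0,3}(2/Λ)²D²ε₀ + C_{0,2}(2/Λ)(Dε₀+2Dε₁) + C_{0,1}ε₂)/m(ω̃)²`);
* the three `ℓ²` sums **`sum_norm_sq_gridSymbol_sub_le`**, **`sum_norm_sq_fwdDiff_two_time_gridSymbol_sub_le`**,
  **`sum_norm_sq_fwdDiff_two_space_gridSymbol_sub_le`** — every summand carries at least `1/m(ω)⁴`, so all three are uniform in the Matsubara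
  cutoff `M` up to the four time-edge points (`O(β⁴/M⁴)`), exactly as in the one-frame file.

The decay constant of `Sᵀ(C^K_{>Λ} − C^{K′}_{>Λ})S` (row/column sums, entry sup) follows in `HubbardUVCovarianceCTFrameDefect`.
Everything is proved; no definitions; no named facts.

## Sources

G. Benfatto, A. Giuliani, V. Mastropietro, Ann. Henri Poincaré 7 (2006) 809–898, §2.1 (2.3), §2.2 (2.23), (2.36aa), Lemma 2.2, App. A1
(`BenfattoGiulianiMastropietro2006`); M. Salmhofer, *Renormalization* (1999), §4.2.4–4.2.5 (4.63), (4.70) (`Salmhofer1999`).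
The `[cite: …]` tags LOCATE the constructs; the statements are routine instances.
-/

noncomputable section

namespace Literature.MathematicalPhysics.QuantumLattice

open Literature.Probability.LatticeModels Literature.Analysis.SpecialFunctions Finset Complex

variable {L M N : ℕ}

/-! ### The band difference of two frames along lattice lines -/

/-- The value bound of a band-difference datum at the point itself (`t = 0`). [cite: BenfattoGiulianiMastropietro2006, §2.2 (2.23)] -/
theorem abs_eval_sub_le_of_lineDiff {K K' : TrigPolyC4v} {ε₀ ε₁ ε₂ : ℝ}
    (hΔ : ∀ (p : Fin 2 → ℝ) (l : Fin 2), ∃ d' d'' : ℝ → ℝ,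
      (∀ t, HasDerivAt (fun t => K.eval (p + t • Pi.single l 1) - K'.eval (p + t • Pi.single l 1)) (d' t) t) ∧
        (∀ t, HasDerivAt d' (d'' t) t) ∧
          ∀ t, |K.eval (p + t • Pi.single l 1) - K'.eval (p + t • Pi.single l 1)| ≤ ε₀ ∧ |d' t| ≤ ε₁ ∧ |d'' t| ≤ ε₂) (p : Fin 2 → ℝ) :
    |K.eval p - K'.eval p| ≤ ε₀ := by
  obtain ⟨d', d'', -, -, hb⟩ := hΔ p 0
  simpa using (hb 0).1

/-- The padded symbol is additive in the symbol: `G[p − p′] = G[p] − G[p′]`. [cite: BenfattoGiulianiMastropietro2006, §2.1 (2.3)] -/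
theorem gridSymbol_sub (β : ℝ) (p p' : FreqMomentum L M × Fin 2 → ℂ) (σ : Fin 2) (q₀ : TorusSite 1 N) (qv : TorusSite 2 L) :
    gridSymbol L M N β (fun ks => p ks - p' ks) σ q₀ qv = gridSymbol L M N β p σ q₀ qv - gridSymbol L M N β p' σ q₀ qv := by
  unfold gridSymbol
  split_ifs with h
  · ring
  · simp

/-- The continuum bands of two frames differ by minus the frame difference. [cite: FeldmanSalmhoferTrubowitz1996, §1 Discussion (E = e + K)] -/
theorem ctBandFn_sub (μ : ℝ) (K K' : TrigPolyC4v) (p : Fin 2 → ℝ) : ctBandFn μ K p - ctBandFn μ K' p = -(K.eval p - K'.eval p) := by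
  unfold ctBandFn; ring

/-- The lattice bands of two frames differ by minus the frame difference at the lattice momentum. [cite: FeldmanSalmhoferTrubowitz1996, §1 Discussion (E = e + K)] -/
theorem nambuXiCT_sub [NeZero L] (μ : ℝ) (K K' : TrigPolyC4v) (k : TorusSite 2 L) :
    nambuXiCT L μ K k - nambuXiCT L μ K' k = -(K.eval (latticeMomentum L k) - K'.eval (latticeMomentum L k)) := by
  rw [nambuXiCT_eq_ctBandFn, nambuXiCT_eq_ctBandFn, ctBandFn_sub]

/-- Along a lattice line the bands of two frames differ by minus the frame difference. [cite: FeldmanSalmhoferTrubowitz1996, §1 Discussion (E = e + K)] -/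
theorem ctLine_sub (μ : ℝ) (K K' : TrigPolyC4v) (p : Fin 2 → ℝ) (l : Fin 2) (t : ℝ) :
    ctLine μ K p l t - ctLine μ K' p l t = -(K.eval (p + t • Pi.single l 1) - K'.eval (p + t • Pi.single l 1)) := by
  unfold ctLine; rw [ctBandFn_sub]

section Symbol

variable [NeZero L] {β μ Λ : ℝ} {K K' : TrigPolyC4v} {ε₀ ε₁ ε₂ : ℝ}

/-- `#(ℤ/L)² = L²`. [folklore] -/
private theorem card_torusSite_two''' : Fintype.card (TorusSite 2 L) = L ^ 2 := by
  rw [Fintype.card_fun, ZMod.card, Fintype.card_fin]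

/-- **The padded grid symbol of the DIFFERENCE**: `(βL²)⁻²·βL²·(Ψ₁(ω̃_{q₀}, e_K(q⃗)) − Ψ₁(ω̃_{q₀}, e_{K′}(q⃗)))` if `val q₀ < 2M`, else `0`.
[cite: BenfattoGiulianiMastropietro2006, §2.1 (2.3)] -/
theorem gridSymbol_uvSymbolCT_sub_eq (hβ : 0 < β) (μ : ℝ) (K K' : TrigPolyC4v) (Λ : ℝ) (σ : Fin 2) (q₀ : TorusSite 1 N) (qv : TorusSite 2 L) :
    gridSymbol L M N β (fun ks => uvSymbolCT L M β μ K Λ ks - uvSymbolCT L M β μ K' Λ ks) σ q₀ qv =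
      if (q₀ 0).val < 2 * M then ((1 / (β * (L : ℝ) ^ 2) : ℝ) : ℂ) ^ 2 * ((((β * (L : ℝ) ^ 2 : ℝ)) : ℂ) *
        (uvSymbolOneFn Λ (gridFreq M N β q₀, nambuXiCT L μ K qv) - uvSymbolOneFn Λ (gridFreq M N β q₀, nambuXiCT L μ K' qv))) else 0 := by
  rw [gridSymbol_sub, gridSymbol_uvSymbolCT_eq hβ, gridSymbol_uvSymbolCT_eq hβ]
  split_ifs with h
  · rw [uvSymbolFn_eq_mul_uvSymbolOneFn, uvSymbolFn_eq_mul_uvSymbolOneFn]; ring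
  · simp

/-- **Pointwise**: `‖(G_K − G_{K′})(q₀,q⃗)‖ ≤ (βL²)⁻²·βL²·C_{0,1}ε₀/max(|ω̃_{q₀}|,Λ/2)²` under `|K − K′| ≤ ε₀` at the lattice momenta.
[cite: BenfattoGiulianiMastropietro2006, (2.36aa)] -/
theorem norm_gridSymbol_sub_le (hβ : 0 < β) (hΛ : 0 < Λ) (hε₀ : ∀ k : TorusSite 2 L, |K.eval (latticeMomentum L k) - K'.eval (latticeMomentum L k)| ≤ ε₀)
    (σ : Fin 2) (q₀ : TorusSite 1 N) (qv : TorusSite 2 L) :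
    ‖gridSymbol L M N β (fun ks => uvSymbolCT L M β μ K Λ ks - uvSymbolCT L M β μ K' Λ ks) σ q₀ qv‖ ≤
      (1 / (β * (L : ℝ) ^ 2)) ^ 2 * ((β * (L : ℝ) ^ 2) * (uvMixedConst Λ 0 1 * ε₀ / max |gridFreq M N β q₀| (Λ / 2) ^ 2)) := by
  have hε : 0 ≤ ε₀ := (abs_nonneg _).trans (hε₀ qv)
  have hC := uvMixedConst_nonneg Λ 0 1
  have hm := uvEnv_pos hΛ (gridFreq M N β q₀)
  rw [gridSymbol_uvSymbolCT_sub_eq hβ]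
  split_ifs with h
  · rw [norm_mul, norm_pow, Complex.norm_real, Real.norm_eq_abs, abs_of_nonneg (by positivity), norm_mul, Complex.norm_real,
      Real.norm_eq_abs, abs_of_nonneg (by positivity)]
    refine mul_le_mul_of_nonneg_left (mul_le_mul_of_nonneg_left ?_ (by positivity)) (by positivity)
    have h1 := norm_uvMixedFn_sub_snd_le hΛ 0 0 (gridFreq M N β q₀) (nambuXiCT L μ K qv) (nambuXiCT L μ K' qv)
    rw [uvMixedFn_zero_zero] at h1
    calc ‖uvSymbolOneFn Λ (gridFreq M N β q₀, nambuXiCT L μ K qv) - uvSymbolOneFn Λ (gridFreq M N β q₀, nambuXiCT L μ K' qv)‖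
        ≤ uvMixedConst Λ 0 (0 + 1) / max |gridFreq M N β q₀| (Λ / 2) ^ (0 + 0 + 2) * |nambuXiCT L μ K qv - nambuXiCT L μ K' qv| := h1
      _ ≤ uvMixedConst Λ 0 1 / max |gridFreq M N β q₀| (Λ / 2) ^ 2 * ε₀ := by
          rw [nambuXiCT_sub, abs_neg]
          simpa using mul_le_mul_of_nonneg_left (hε₀ qv) (by positivity : 0 ≤ uvMixedConst Λ 0 1 / max |gridFreq M N β q₀| (Λ / 2) ^ 2)
      _ = uvMixedConst Λ 0 1 * ε₀ / max |gridFreq M N β q₀| (Λ / 2) ^ 2 := by ring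
  · rw [norm_zero]; positivity

/-- **At the edge frequencies** (`val q₀ ≤ 1` or `2M−2 ≤ val q₀`, `2 ≤ M`): `‖(G_K − G_{K′})(q₀,q⃗)‖ ≤ (βL²)⁻²·βL²·C_{0,1}ε₀·(β/(π(2M−3)))²`.
[cite: BenfattoGiulianiMastropietro2006, §2.1 (2.3)] -/
theorem norm_gridSymbol_sub_le_edge (hβ : 0 < β) (hΛ : 0 < Λ) (hM : 2 ≤ M)
    (hε₀ : ∀ k : TorusSite 2 L, |K.eval (latticeMomentum L k) - K'.eval (latticeMomentum L k)| ≤ ε₀)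
    (σ : Fin 2) (q₀ : TorusSite 1 N) (qv : TorusSite 2 L) (hq : (q₀ 0).val ≤ 1 ∨ 2 * M - 2 ≤ (q₀ 0).val) :
    ‖gridSymbol L M N β (fun ks => uvSymbolCT L M β μ K Λ ks - uvSymbolCT L M β μ K' Λ ks) σ q₀ qv‖ ≤
      (1 / (β * (L : ℝ) ^ 2)) ^ 2 * ((β * (L : ℝ) ^ 2) * (uvMixedConst Λ 0 1 * ε₀ * (β / (Real.pi * (2 * M - 3))) ^ 2)) := by
  have hε : 0 ≤ ε₀ := (abs_nonneg _).trans (hε₀ qv)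
  have hC := uvMixedConst_nonneg Λ 0 1
  have hM' : (0 : ℝ) < 2 * M - 3 := by
    have : (2 : ℝ) ≤ M := by exact_mod_cast hM
    linarith
  have hfreq := abs_gridFreq_ge (M := M) hβ q₀ hq
  have hpos : 0 < Real.pi * (2 * M - 3) / β := by positivity
  refine (norm_gridSymbol_sub_le hβ hΛ hε₀ σ q₀ qv).trans (mul_le_mul_of_nonneg_left (mul_le_mul_of_nonneg_left ?_ (by positivity)) (by positivity))
  rw [div_eq_mul_one_div]
  refine mul_le_mul_of_nonneg_left ?_ (by positivity)
  have hle : Real.pi * (2 * M - 3) / β ≤ max |gridFreq M N β q₀| (Λ / 2) := hfreq.trans (le_max_left _ _)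
  have h1 : 1 / max |gridFreq M N β q₀| (Λ / 2) ≤ β / (Real.pi * (2 * M - 3)) := by
    rw [one_div_le (uvEnv_pos hΛ _) (by positivity), one_div_div]; exact hle
  calc 1 / max |gridFreq M N β q₀| (Λ / 2) ^ 2 = (1 / max |gridFreq M N β q₀| (Λ / 2)) ^ 2 := by rw [one_div_pow]
    _ ≤ (β / (Real.pi * (2 * M - 3))) ^ 2 := pow_le_pow_left₀ (by positivity) h1 2

/-! ### The time direction -/

variable [NeZero N]

/-- **The second time difference of the difference symbol in the interior** (`val q₀ + 2 < 2M ≤ N`): `(βL²)⁻²·βL²` times the second difference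
of `ω ↦ Ψ₁(ω,e_K) − Ψ₁(ω,e_{K′})` at step `2π/β`. [cite: BenfattoGiulianiMastropietro2006, (2.36aa)] -/
theorem fwdDiff_two_time_gridSymbol_sub_eq (hβ : 0 < β) (hMN : 2 * M ≤ N) (σ : Fin 2) (q₀ : TorusSite 1 N) (qv : TorusSite 2 L)
    (h : (q₀ 0).val + 2 < 2 * M) :
    (fwdDiff (fun _ : Fin 1 => (1 : ZMod N)))^[2]
        (fun q => gridSymbol L M N β (fun ks => uvSymbolCT L M β μ K Λ ks - uvSymbolCT L M β μ K' Λ ks) σ q qv) q₀ =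
      ((1 / (β * (L : ℝ) ^ 2) : ℝ) : ℂ) ^ 2 * ((((β * (L : ℝ) ^ 2 : ℝ)) : ℂ) *
        (fwdDiff (2 * Real.pi / β))^[2] (fun ω => uvSymbolOneFn Λ (ω, nambuXiCT L μ K qv) - uvSymbolOneFn Λ (ω, nambuXiCT L μ K' qv))
          (gridFreq M N β q₀)) := by
  have h0 : (q₀ 0).val < 2 * M := by omega
  have h1N : (q₀ 0).val + 1 < N := by omega
  have h2N : (q₀ 0).val + 2 < N := by omega
  have hv1 : ((q₀ + 1 • (fun _ : Fin 1 => (1 : ZMod N))) 0).val < 2 * M := by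
    rw [val_add_smul_timeStep q₀ (by omega), Nat.mod_eq_of_lt h1N]; omega
  have hv2 : ((q₀ + 2 • (fun _ : Fin 1 => (1 : ZMod N))) 0).val < 2 * M := by
    rw [val_add_smul_timeStep q₀ (by omega), Nat.mod_eq_of_lt h2N]; omega
  rw [fwdDiff_iter_two_apply, fwdDiff_iter_two_apply, gridSymbol_uvSymbolCT_sub_eq hβ, gridSymbol_uvSymbolCT_sub_eq hβ,
    gridSymbol_uvSymbolCT_sub_eq hβ, if_pos hv2, if_pos hv1, if_pos h0, gridFreq_add_smul β q₀ 2 h2N, gridFreq_add_smul β q₀ 1 h1N]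
  simp only [nsmul_eq_mul, zsmul_eq_mul]
  push_cast
  ring

/-- **Interior bound**: `‖(Δ_u)²(G_K − G_{K′})(·,q⃗)(q₀)‖ ≤ (βL²)⁻²·βL²·(2π/β)²·C_{2,1}ε₀/max(|ω̃| − 4π/β, Λ/2)⁴` for `val q₀ + 2 < 2M ≤ N`.
[cite: BenfattoGiulianiMastropietro2006, (2.36aa)] -/
theorem norm_fwdDiff_two_time_gridSymbol_sub_le_interior (hβ : 0 < β) (hΛ : 0 < Λ)
    (hε₀ : ∀ k : TorusSite 2 L, |K.eval (latticeMomentum L k) - K'.eval (latticeMomentum L k)| ≤ ε₀) (hMN : 2 * M ≤ N)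
    (σ : Fin 2) (q₀ : TorusSite 1 N) (qv : TorusSite 2 L) (h : (q₀ 0).val + 2 < 2 * M) :
    ‖(fwdDiff (fun _ : Fin 1 => (1 : ZMod N)))^[2]
        (fun q => gridSymbol L M N β (fun ks => uvSymbolCT L M β μ K Λ ks - uvSymbolCT L M β μ K' Λ ks) σ q qv) q₀‖ ≤
      (1 / (β * (L : ℝ) ^ 2)) ^ 2 * ((β * (L : ℝ) ^ 2) * ((2 * Real.pi / β) ^ 2 *
        (uvMixedConst Λ 2 1 * ε₀ / max (|gridFreq M N β q₀| - 2 * (2 * Real.pi / β)) (Λ / 2) ^ 4))) := by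
  have hε : 0 ≤ ε₀ := (abs_nonneg _).trans (hε₀ qv)
  have hC := uvMixedConst_nonneg Λ 2 1
  have hms : 0 < max (|gridFreq M N β q₀| - 2 * (2 * Real.pi / β)) (Λ / 2) := lt_max_of_lt_right (by positivity)
  rw [fwdDiff_two_time_gridSymbol_sub_eq hβ hMN σ q₀ qv h, norm_mul, norm_pow, Complex.norm_real, Real.norm_eq_abs,
    abs_of_nonneg (by positivity), norm_mul, Complex.norm_real, Real.norm_eq_abs, abs_of_nonneg (by positivity)]
  refine mul_le_mul_of_nonneg_left (mul_le_mul_of_nonneg_left ?_ (by positivity)) (by positivity)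
  have h2 := norm_fwdDiff_iter_uvSymbolOneFn_sub_le hΛ 2 (h₀ := 2 * Real.pi / β) (by positivity) (gridFreq M N β q₀)
    (nambuXiCT L μ K qv) (nambuXiCT L μ K' qv)
  refine h2.trans ?_
  rw [nambuXiCT_sub, abs_neg, Nat.cast_ofNat]
  refine mul_le_mul_of_nonneg_left ?_ (by positivity)
  exact div_le_div_of_nonneg_right (mul_le_mul_of_nonneg_left (hε₀ qv) hC) (by positivity)

/-- **The non-interior second time differences of the difference are edge-sized**: for `2M ≤ val q₀ + 2` (`2 ≤ M`, `2M ≤ N`),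
`‖(Δ_u)²(G_K − G_{K′})(·,q⃗)(q₀)‖ ≤ 4·(βL²)⁻²·βL²·C_{0,1}ε₀·(β/(π(2M−3)))²`. [cite: BenfattoGiulianiMastropietro2006, (2.36aa)] -/
theorem norm_fwdDiff_two_time_gridSymbol_sub_le_edge (hβ : 0 < β) (hΛ : 0 < Λ) (hM : 2 ≤ M) (hMN : 2 * M ≤ N)
    (hε₀ : ∀ k : TorusSite 2 L, |K.eval (latticeMomentum L k) - K'.eval (latticeMomentum L k)| ≤ ε₀)
    (σ : Fin 2) (q₀ : TorusSite 1 N) (qv : TorusSite 2 L) (h : 2 * M ≤ (q₀ 0).val + 2) :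
    ‖(fwdDiff (fun _ : Fin 1 => (1 : ZMod N)))^[2]
        (fun q => gridSymbol L M N β (fun ks => uvSymbolCT L M β μ K Λ ks - uvSymbolCT L M β μ K' Λ ks) σ q qv) q₀‖ ≤
      4 * ((1 / (β * (L : ℝ) ^ 2)) ^ 2 * ((β * (L : ℝ) ^ 2) * (uvMixedConst Λ 0 1 * ε₀ * (β / (Real.pi * (2 * M - 3))) ^ 2))) := by
  set G := fun q => gridSymbol L M N β (fun ks => uvSymbolCT L M β μ K Λ ks - uvSymbolCT L M β μ K' Λ ks) σ q qv with hG
  set E := (1 / (β * (L : ℝ) ^ 2)) ^ 2 * ((β * (L : ℝ) ^ 2) * (uvMixedConst Λ 0 1 * ε₀ * (β / (Real.pi * (2 * M - 3))) ^ 2)) with hE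
  have hval : ∀ m : ℕ, m ≤ 2 → ((q₀ + m • (fun _ : Fin 1 => (1 : ZMod N))) 0).val ≤ 1 ∨
      2 * M - 2 ≤ ((q₀ + m • (fun _ : Fin 1 => (1 : ZMod N))) 0).val := by
    intro m hm
    have hmN : m < N := by omega
    have hv := (q₀ 0).val_lt
    rw [val_add_smul_timeStep q₀ hmN]
    by_cases hlt : (q₀ 0).val + m < N
    · rw [Nat.mod_eq_of_lt hlt]; right; omega
    · left
      rw [not_lt] at hlt
      have : ((q₀ 0).val + m) % N = (q₀ 0).val + m - N := by
        rw [Nat.mod_eq_sub_mod hlt, Nat.mod_eq_of_lt (by omega)]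
      rw [this]; omega
  have hpt : ∀ m : ℕ, m ≤ 2 → ‖G (q₀ + m • (fun _ : Fin 1 => (1 : ZMod N)))‖ ≤ E := fun m hm =>
    norm_gridSymbol_sub_le_edge hβ hΛ hM hε₀ σ _ qv (hval m hm)
  have h0 := hpt 0 (by norm_num)
  rw [zero_smul, add_zero] at h0
  rw [fwdDiff_iter_two_apply]
  calc _ ≤ ‖G (q₀ + 2 • fun _ : Fin 1 => (1 : ZMod N)) - (2 : ℤ) • G (q₀ + 1 • fun _ : Fin 1 => (1 : ZMod N))‖ + ‖G q₀‖ :=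
        norm_add_le _ _
    _ ≤ (E + 2 * E) + E := by
        refine add_le_add ((norm_sub_le _ _).trans (add_le_add (hpt 2 le_rfl) ?_)) h0
        rw [zsmul_eq_mul, norm_mul, Int.cast_ofNat, Complex.norm_ofNat]
        exact mul_le_mul_of_nonneg_left (hpt 1 (by norm_num)) (by norm_num)
    _ = 4 * E := by ring

omit [NeZero L] in
/-- **In the padding the second time differences of ANY padded symbol vanish** (`2M ≤ val q₀`, `val q₀ + 2 < N`).
[cite: BenfattoGiulianiMastropietro2006, (2.36aa)] -/
theorem fwdDiff_two_time_gridSymbol_eq_zero_of_padding' (p : FreqMomentum L M × Fin 2 → ℂ) (σ : Fin 2) (q₀ : TorusSite 1 N)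
    (qv : TorusSite 2 L) (h1 : 2 * M ≤ (q₀ 0).val) (h2 : (q₀ 0).val + 2 < N) :
    (fwdDiff (fun _ : Fin 1 => (1 : ZMod N)))^[2] (fun q => gridSymbol L M N β p σ q qv) q₀ = 0 := by
  have hz : ∀ m : ℕ, m ≤ 2 → gridSymbol L M N β p σ (q₀ + m • (fun _ : Fin 1 => (1 : ZMod N))) qv = 0 := by
    intro m hm
    have hv : ¬ ((q₀ + m • (fun _ : Fin 1 => (1 : ZMod N))) 0).val < 2 * M := by
      rw [val_add_smul_timeStep q₀ (by omega), Nat.mod_eq_of_lt (by omega)]; omega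
    unfold gridSymbol
    rw [dif_neg hv]
  have h0 := hz 0 (by norm_num)
  rw [zero_smul, add_zero] at h0
  rw [fwdDiff_iter_two_apply, hz 2 le_rfl, hz 1 (by norm_num), h0]
  simp

/-! ### The band direction: the second space difference of the difference along a lattice line -/

omit [NeZero N] in
/-- **The second space difference of the difference symbol**: `(βL²)⁻²·βL²` times the second difference at step `2π/L` of
`t ↦ Ψ₁(ω̃, e_K(p + t e_l)) − Ψ₁(ω̃, e_{K′}(p + t e_l))` (zero beyond the window). [cite: BenfattoGiulianiMastropietro2006, (2.36aa)] -/
theorem fwdDiff_two_space_gridSymbol_sub_eq (hβ : 0 < β) (σ : Fin 2) (q₀ : TorusSite 1 N) (qv : TorusSite 2 L) (l : Fin 2) :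
    (fwdDiff (Pi.single l (1 : ZMod L) : TorusSite 2 L))^[2]
        (gridSymbol L M N β (fun ks => uvSymbolCT L M β μ K Λ ks - uvSymbolCT L M β μ K' Λ ks) σ q₀) qv =
      if (q₀ 0).val < 2 * M then ((1 / (β * (L : ℝ) ^ 2) : ℝ) : ℂ) ^ 2 * ((((β * (L : ℝ) ^ 2 : ℝ)) : ℂ) *
        ((fun t => uvMixedFn Λ 0 0 (gridFreq M N β q₀, ctLine μ K (latticeMomentum L qv) l t) -
            uvMixedFn Λ 0 0 (gridFreq M N β q₀, ctLine μ K' (latticeMomentum L qv) l t)) (0 + 2 * (2 * Real.pi / L)) -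
          (2 : ℝ) • (fun t => uvMixedFn Λ 0 0 (gridFreq M N β q₀, ctLine μ K (latticeMomentum L qv) l t) -
            uvMixedFn Λ 0 0 (gridFreq M N β q₀, ctLine μ K' (latticeMomentum L qv) l t)) (0 + 2 * Real.pi / L) +
          (fun t => uvMixedFn Λ 0 0 (gridFreq M N β q₀, ctLine μ K (latticeMomentum L qv) l t) -
            uvMixedFn Λ 0 0 (gridFreq M N β q₀, ctLine μ K' (latticeMomentum L qv) l t)) 0)) else 0 := by
  have hsub : ∀ qv', gridSymbol L M N β (fun ks => uvSymbolCT L M β μ K Λ ks - uvSymbolCT L M β μ K' Λ ks) σ q₀ qv' =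
      gridSymbol L M N β (uvSymbolCT L M β μ K Λ) σ q₀ qv' - gridSymbol L M N β (uvSymbolCT L M β μ K' Λ) σ q₀ qv' :=
    fun qv' => gridSymbol_sub β _ _ σ q₀ qv'
  have h0 := gridSymbol_uvSymbolCT_add_smul_eq (μ := μ) (K := K) (Λ := Λ) (M := M) (N := N) hβ σ q₀ qv l 0
  have h0' := gridSymbol_uvSymbolCT_add_smul_eq (μ := μ) (K := K') (Λ := Λ) (M := M) (N := N) hβ σ q₀ qv l 0
  rw [zero_smul, add_zero] at h0 h0'
  rw [fwdDiff_iter_two_apply, hsub, hsub, hsub, gridSymbol_uvSymbolCT_add_smul_eq hβ, gridSymbol_uvSymbolCT_add_smul_eq hβ,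
    gridSymbol_uvSymbolCT_add_smul_eq hβ, gridSymbol_uvSymbolCT_add_smul_eq hβ, h0, h0']
  simp only [uvPathFn, ← uvSymbolFn_eq_uvSymbolFnXi, uvSymbolFn_eq_mul_uvSymbolOneFn, uvMixedFn_zero_zero]
  split_ifs with h
  · push_cast
    rw [Complex.real_smul, zsmul_eq_mul]
    push_cast
    ring
  · simp

omit [NeZero N] in
/-- **Space bound**: under `UVLineBound μ K D`, `UVLineBound μ K′ D` and the band-difference datum `hΔ` (`0 ≤ D, ε₀, ε₁`),
`‖(Δ_{e_l})²(G_K − G_{K′})(q₀,·)(q⃗)‖ ≤ (βL²)⁻²·βL²·(2π/L)²·(C_{0,3}(2/Λ)²D²ε₀ + C_{0,2}(2/Λ)(Dε₀ + 2Dε₁) + C_{0,1}ε₂)/max(|ω̃_{q₀}|,Λ/2)²`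
(mean value twice along the line for the difference of the two compositions). [cite: BenfattoGiulianiMastropietro2006, (2.36aa)] -/
theorem norm_fwdDiff_two_space_gridSymbol_sub_le (hβ : 0 < β) (hΛ : 0 < Λ) {D : ℝ} (hD : 0 ≤ D) (hε₀ : 0 ≤ ε₀) (hε₁ : 0 ≤ ε₁)
    (hline : UVLineBound μ K D) (hline' : UVLineBound μ K' D) (hΔ : ∀ (p : Fin 2 → ℝ) (l : Fin 2), ∃ d' d'' : ℝ → ℝ,
      (∀ t, HasDerivAt (fun t => K.eval (p + t • Pi.single l 1) - K'.eval (p + t • Pi.single l 1)) (d' t) t) ∧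
        (∀ t, HasDerivAt d' (d'' t) t) ∧
          ∀ t, |K.eval (p + t • Pi.single l 1) - K'.eval (p + t • Pi.single l 1)| ≤ ε₀ ∧ |d' t| ≤ ε₁ ∧ |d'' t| ≤ ε₂)
    (σ : Fin 2) (q₀ : TorusSite 1 N) (qv : TorusSite 2 L) (l : Fin 2) :
    ‖(fwdDiff (Pi.single l (1 : ZMod L) : TorusSite 2 L))^[2]
        (gridSymbol L M N β (fun ks => uvSymbolCT L M β μ K Λ ks - uvSymbolCT L M β μ K' Λ ks) σ q₀) qv‖ ≤
      (1 / (β * (L : ℝ) ^ 2)) ^ 2 * ((β * (L : ℝ) ^ 2) * ((2 * Real.pi / L) ^ 2 *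
        ((uvMixedConst Λ 0 3 * (2 / Λ) ^ 2 * D ^ 2 * ε₀ + uvMixedConst Λ 0 2 * (2 / Λ) * (D * ε₀ + 2 * D * ε₁) + uvMixedConst Λ 0 1 * ε₂) /
          max |gridFreq M N β q₀| (Λ / 2) ^ 2))) := by
  have hL : (0 : ℝ) < L := by exact_mod_cast Nat.pos_of_ne_zero (NeZero.ne L)
  have hC1 := uvMixedConst_nonneg Λ 0 1
  have hC2 := uvMixedConst_nonneg Λ 0 2
  have hC3 := uvMixedConst_nonneg Λ 0 3
  have hm := uvEnv_pos hΛ (gridFreq M N β q₀)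
  set p := latticeMomentum L qv with hp
  -- line data of the two bands and of their difference
  obtain ⟨e₁', e₁'', he₁', he₁'', hb₁⟩ := hline p l
  obtain ⟨e₂', e₂'', he₂', he₂'', hb₂⟩ := hline' p l
  obtain ⟨d', d'', hd', hd'', hbd⟩ := hΔ p l
  have hε₂ : 0 ≤ ε₂ := (abs_nonneg _).trans (hbd 0).2.2
  have hsub0 : ∀ t, |ctLine μ K p l t - ctLine μ K' p l t| ≤ ε₀ := fun t => by
    rw [ctLine_sub, abs_neg]; exact (hbd t).1
  -- uniqueness of derivatives: `e₁′ − e₂′ = −d′`, `e₁″ − e₂″ = −d″`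
  have hd1 : ∀ t, e₁' t - e₂' t = -d' t := by
    intro t
    have h1 : HasDerivAt (fun t => ctLine μ K p l t - ctLine μ K' p l t) (e₁' t - e₂' t) t := (he₁' t).sub (he₂' t)
    have h2 : HasDerivAt (fun t => ctLine μ K p l t - ctLine μ K' p l t) (-d' t) t := by
      have hfun : (fun t => ctLine μ K p l t - ctLine μ K' p l t) =
          fun t => -(K.eval (p + t • Pi.single l 1) - K'.eval (p + t • Pi.single l 1)) := funext fun t => ctLine_sub μ K K' p l t
      rw [hfun]; exact (hd' t).neg
    exact h1.unique h2
  have hsub1 : ∀ t, |e₁' t - e₂' t| ≤ ε₁ := fun t => by rw [hd1 t, abs_neg]; exact (hbd t).2.1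
  have hd2 : ∀ t, e₁'' t - e₂'' t = -d'' t := by
    intro t
    have h1 : HasDerivAt (fun t => e₁' t - e₂' t) (e₁'' t - e₂'' t) t := (he₁'' t).sub (he₂'' t)
    have h2 : HasDerivAt (fun t => e₁' t - e₂' t) (-d'' t) t := by
      have hfun : (fun t => e₁' t - e₂' t) = fun t => -d' t := funext hd1
      rw [hfun]; exact (hd'' t).neg
    exact h1.unique h2
  have hsub2 : ∀ t, |e₁'' t - e₂'' t| ≤ ε₂ := fun t => by rw [hd2 t, abs_neg]; exact (hbd t).2.2
  have hRHS : 0 ≤ (1 / (β * (L : ℝ) ^ 2)) ^ 2 * ((β * (L : ℝ) ^ 2) * ((2 * Real.pi / L) ^ 2 *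
      ((uvMixedConst Λ 0 3 * (2 / Λ) ^ 2 * D ^ 2 * ε₀ + uvMixedConst Λ 0 2 * (2 / Λ) * (D * ε₀ + 2 * D * ε₁) + uvMixedConst Λ 0 1 * ε₂) /
        max |gridFreq M N β q₀| (Λ / 2) ^ 2))) := by positivity
  rw [fwdDiff_two_space_gridSymbol_sub_eq hβ]
  split_ifs with h
  · rw [norm_mul, norm_pow, Complex.norm_real, Real.norm_eq_abs, abs_of_nonneg (by positivity), norm_mul, Complex.norm_real,
      Real.norm_eq_abs, abs_of_nonneg (by positivity)]
    refine mul_le_mul_of_nonneg_left (mul_le_mul_of_nonneg_left ?_ (by positivity)) (by positivity)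
    have hmain := norm_fwdDiff_two_uvMixedFn_path_sub_le (Λ := Λ) (p₁ := ctLine μ K p l) (p₂ := ctLine μ K' p l) hΛ hD hε₀ hε₁
      he₁' he₂' he₁'' he₂'' (fun t => (hb₁ t).1) (fun t => (hb₂ t).1) (fun t => (hb₁ t).2) hsub0 hsub1 hsub2 0 (h := 2 * Real.pi / L)
      (by positivity) (gridFreq M N β q₀) 0
    simpa using hmain
  · rw [norm_zero]; exact hRHS

/-! ### The three `ℓ²` sums of the difference symbol -/

/-- **`Σ_{q₀,q⃗} ‖G_K − G_{K′}‖² ≤ L²·(βL²)⁻⁴·(βL²)²·(C_{0,1}ε₀)²·(2/Λ)²·2β/Λ`** (`2M ≤ N`). [cite: BenfattoGiulianiMastropietro2006, §2.8 (2.80)] -/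
theorem sum_norm_sq_gridSymbol_sub_le (hβ : 0 < β) (hΛ : 0 < Λ)
    (hε₀ : ∀ k : TorusSite 2 L, |K.eval (latticeMomentum L k) - K'.eval (latticeMomentum L k)| ≤ ε₀) (hMN : 2 * M ≤ N) (σ : Fin 2) :
    ∑ q₀ : TorusSite 1 N, ∑ qv : TorusSite 2 L,
        ‖gridSymbol L M N β (fun ks => uvSymbolCT L M β μ K Λ ks - uvSymbolCT L M β μ K' Λ ks) σ q₀ qv‖ ^ 2 ≤
      (L : ℝ) ^ 2 * ((1 / (β * (L : ℝ) ^ 2)) ^ 4 * (β * (L : ℝ) ^ 2) ^ 2 * (uvMixedConst Λ 0 1 * ε₀) ^ 2 * ((2 / Λ) ^ (2 * 1) * (2 * β / Λ))) := by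
  set c := β * (L : ℝ) ^ 2 with hc
  set A := uvMixedConst Λ 0 1 * ε₀ with hA
  have hpt : ∀ (q₀ : TorusSite 1 N) (qv : TorusSite 2 L),
      ‖gridSymbol L M N β (fun ks => uvSymbolCT L M β μ K Λ ks - uvSymbolCT L M β μ K' Λ ks) σ q₀ qv‖ ^ 2 ≤
        if (q₀ 0).val < 2 * M then (1 / c) ^ 4 * c ^ 2 * A ^ 2 * (1 / max |gridFreq M N β q₀| (Λ / 2) ^ (2 * 1 + 2)) else 0 := by
    intro q₀ qv
    split_ifs with hq
    · have h := norm_gridSymbol_sub_le (μ := μ) (Λ := Λ) (M := M) (N := N) hβ hΛ hε₀ σ q₀ qv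
      have hm := uvEnv_pos hΛ (gridFreq M N β q₀)
      refine (pow_le_pow_left₀ (norm_nonneg _) h 2).trans (le_of_eq ?_)
      rw [← hc, ← hA]
      field_simp
    · rw [gridSymbol_uvSymbolCT_sub_eq hβ, if_neg hq, norm_zero, zero_pow two_ne_zero]
  refine (sum_le_sum fun q₀ _ => sum_le_sum fun qv _ => hpt q₀ qv).trans ?_
  rw [sum_sum_window_eq hMN β (fun ω => (1 / c) ^ 4 * c ^ 2 * A ^ 2 * (1 / max |ω| (Λ / 2) ^ (2 * 1 + 2))), ← mul_sum]
  exact mul_le_mul_of_nonneg_left (mul_le_mul_of_nonneg_left (sum_inv_uvEnv_pow_le hβ hΛ M 1) (by positivity)) (by positivity)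

/-- **`Σ_{q₀,q⃗} ‖(Δ_u)²(G_K − G_{K′})‖²`** (`2 ≤ M`, `2M ≤ N`): the interior part
`L²·(βL²)⁻⁴(βL²)²(2π/β)⁴(C_{2,1}ε₀)²·[4⁴(2/Λ)⁶·2β/Λ + 8(2/Λ)⁸]` plus the four edge points `4·L²·(4·edge)²`. [cite: BenfattoGiulianiMastropietro2006, §2.8 (2.80)] -/
theorem sum_norm_sq_fwdDiff_two_time_gridSymbol_sub_le (hβ : 0 < β) (hΛ : 0 < Λ)
    (hε₀ : ∀ k : TorusSite 2 L, |K.eval (latticeMomentum L k) - K'.eval (latticeMomentum L k)| ≤ ε₀) (hM : 2 ≤ M) (hMN : 2 * M ≤ N)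
    (σ : Fin 2) :
    ∑ q₀ : TorusSite 1 N, ∑ qv : TorusSite 2 L,
        ‖(fwdDiff (fun _ : Fin 1 => (1 : ZMod N)))^[2]
          (fun q => gridSymbol L M N β (fun ks => uvSymbolCT L M β μ K Λ ks - uvSymbolCT L M β μ K' Λ ks) σ q qv) q₀‖ ^ 2 ≤
      (L : ℝ) ^ 2 * ((1 / (β * (L : ℝ) ^ 2)) ^ 4 * (β * (L : ℝ) ^ 2) ^ 2 * (2 * Real.pi / β) ^ 4 * (uvMixedConst Λ 2 1 * ε₀) ^ 2 *
          (4 ^ 4 * ((2 / Λ) ^ (2 * 4 - 2) * (2 * β / Λ)) + 4 * (2 : ℕ) * (2 / Λ) ^ (2 * 4))) +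
        4 * ((L : ℝ) ^ 2 * (4 * ((1 / (β * (L : ℝ) ^ 2)) ^ 2 * ((β * (L : ℝ) ^ 2) *
          (uvMixedConst Λ 0 1 * ε₀ * (β / (Real.pi * (2 * M - 3))) ^ 2)))) ^ 2) := by
  classical
  set c := β * (L : ℝ) ^ 2 with hc
  set A := uvMixedConst Λ 2 1 * ε₀ with hA
  set Eb := 4 * ((1 / c) ^ 2 * (c * (uvMixedConst Λ 0 1 * ε₀ * (β / (Real.pi * (2 * M - 3))) ^ 2))) with hEb
  set Edge := (univ : Finset (TorusSite 1 N)).filter fun q₀ =>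
    2 * M ≤ (q₀ 0).val + 2 ∧ ¬ (2 * M ≤ (q₀ 0).val ∧ (q₀ 0).val + 2 < N) with hEdge
  set F : TorusSite 1 N → TorusSite 2 L → ℂ := fun q₀ qv => (fwdDiff (fun _ : Fin 1 => (1 : ZMod N)))^[2]
    (fun q => gridSymbol L M N β (fun ks => uvSymbolCT L M β μ K Λ ks - uvSymbolCT L M β μ K' Λ ks) σ q qv) q₀ with hF
  have hpt : ∀ (q₀ : TorusSite 1 N) (qv : TorusSite 2 L), ‖F q₀ qv‖ ^ 2 ≤
      (if (q₀ 0).val < 2 * M then (1 / c) ^ 4 * c ^ 2 * (2 * Real.pi / β) ^ 4 * A ^ 2 *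
          (1 / max (|gridFreq M N β q₀| - (2 : ℕ) * (2 * Real.pi / β)) (Λ / 2) ^ (2 * 4)) else 0) +
        (if q₀ ∈ Edge then Eb ^ 2 else 0) := by
    intro q₀ qv
    have hms : 0 < max (|gridFreq M N β q₀| - (2 : ℕ) * (2 * Real.pi / β)) (Λ / 2) := lt_max_of_lt_right (by positivity)
    by_cases hint : (q₀ 0).val + 2 < 2 * M
    · have h := norm_fwdDiff_two_time_gridSymbol_sub_le_interior (μ := μ) (Λ := Λ) hβ hΛ hε₀ hMN σ q₀ qv hint
      rw [if_pos (show (q₀ 0).val < 2 * M by omega)]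
      refine le_add_of_le_of_nonneg ((pow_le_pow_left₀ (norm_nonneg _) h 2).trans (le_of_eq ?_)) (by split_ifs <;> positivity)
      rw [← hc, ← hA, Nat.cast_ofNat]
      field_simp
    · by_cases hpad : 2 * M ≤ (q₀ 0).val ∧ (q₀ 0).val + 2 < N
      · have h0 := fwdDiff_two_time_gridSymbol_eq_zero_of_padding' (β := β) (M := M)
          (fun ks => uvSymbolCT L M β μ K Λ ks - uvSymbolCT L M β μ K' Λ ks) σ q₀ qv hpad.1 hpad.2
        rw [hF]; dsimp only; rw [h0, norm_zero, zero_pow two_ne_zero]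
        exact add_nonneg (by split_ifs <;> positivity) (by split_ifs <;> positivity)
      · have hmem : q₀ ∈ Edge := mem_filter.2 ⟨mem_univ _, by omega, hpad⟩
        have h := norm_fwdDiff_two_time_gridSymbol_sub_le_edge (μ := μ) (Λ := Λ) hβ hΛ hM hMN hε₀ σ q₀ qv (by omega)
        rw [if_pos hmem]
        refine le_add_of_nonneg_of_le (by split_ifs <;> positivity) ?_
        rw [hEb, hc]
        exact pow_le_pow_left₀ (norm_nonneg _) h 2
  refine (sum_le_sum fun q₀ _ => sum_le_sum fun qv _ => hpt q₀ qv).trans ?_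
  simp only [sum_add_distrib]
  refine add_le_add ?_ ?_
  · rw [sum_sum_window_eq hMN β (fun ω => (1 / c) ^ 4 * c ^ 2 * (2 * Real.pi / β) ^ 4 * A ^ 2 *
      (1 / max (|ω| - (2 : ℕ) * (2 * Real.pi / β)) (Λ / 2) ^ (2 * 4))), ← mul_sum]
    exact mul_le_mul_of_nonneg_left (mul_le_mul_of_nonneg_left (sum_inv_uvEnvShift_pow_le hβ hΛ M 2 (n := 4) (by norm_num))
      (by positivity)) (by positivity)
  · have hrow : ∀ q₀ : TorusSite 1 N, ∑ _qv : TorusSite 2 L, (if q₀ ∈ Edge then Eb ^ 2 else (0 : ℝ)) =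
        if q₀ ∈ Edge then (L : ℝ) ^ 2 * Eb ^ 2 else 0 := by
      intro q₀
      split_ifs
      · rw [sum_const, card_univ, card_torusSite_two''', nsmul_eq_mul, Nat.cast_pow]
      · simp
    simp_rw [hrow]
    rw [← sum_filter, Finset.filter_mem_eq_inter, Finset.univ_inter, sum_const, nsmul_eq_mul]
    have hcard : (Edge.card : ℝ) ≤ 4 := by exact_mod_cast card_timeEdge_le_four (M := M) (N := N)
    have : (0 : ℝ) ≤ (L : ℝ) ^ 2 * Eb ^ 2 := by positivity
    calc (Edge.card : ℝ) * ((L : ℝ) ^ 2 * Eb ^ 2) ≤ 4 * ((L : ℝ) ^ 2 * Eb ^ 2) := mul_le_mul_of_nonneg_right hcard this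
      _ = _ := by rw [hEb, hc]

omit [NeZero N] in
/-- **`Σ_{q₀,q⃗} ‖(Δ_{e_l})²(G_K − G_{K′})‖² ≤ L²·(βL²)⁻⁴(βL²)²(2π/L)⁴·K_Δ²·(2/Λ)²·2β/Λ`**,
`K_Δ = C_{0,3}(2/Λ)²D²ε₀ + C_{0,2}(2/Λ)(Dε₀+2Dε₁) + C_{0,1}ε₂` (`2M ≤ N`). [cite: BenfattoGiulianiMastropietro2006, §2.8 (2.80)] -/
theorem sum_norm_sq_fwdDiff_two_space_gridSymbol_sub_le [NeZero N] (hβ : 0 < β) (hΛ : 0 < Λ) {D : ℝ} (hD : 0 ≤ D) (hε₀ : 0 ≤ ε₀) (hε₁ : 0 ≤ ε₁)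
    (hline : UVLineBound μ K D) (hline' : UVLineBound μ K' D) (hΔ : ∀ (p : Fin 2 → ℝ) (l : Fin 2), ∃ d' d'' : ℝ → ℝ,
      (∀ t, HasDerivAt (fun t => K.eval (p + t • Pi.single l 1) - K'.eval (p + t • Pi.single l 1)) (d' t) t) ∧
        (∀ t, HasDerivAt d' (d'' t) t) ∧
          ∀ t, |K.eval (p + t • Pi.single l 1) - K'.eval (p + t • Pi.single l 1)| ≤ ε₀ ∧ |d' t| ≤ ε₁ ∧ |d'' t| ≤ ε₂) (hMN : 2 * M ≤ N) (σ : Fin 2) (l : Fin 2) :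
    ∑ q₀ : TorusSite 1 N, ∑ qv : TorusSite 2 L,
        ‖(fwdDiff (Pi.single l (1 : ZMod L) : TorusSite 2 L))^[2]
          (gridSymbol L M N β (fun ks => uvSymbolCT L M β μ K Λ ks - uvSymbolCT L M β μ K' Λ ks) σ q₀) qv‖ ^ 2 ≤
      (L : ℝ) ^ 2 * ((1 / (β * (L : ℝ) ^ 2)) ^ 4 * (β * (L : ℝ) ^ 2) ^ 2 * (2 * Real.pi / L) ^ 4 *
        (uvMixedConst Λ 0 3 * (2 / Λ) ^ 2 * D ^ 2 * ε₀ + uvMixedConst Λ 0 2 * (2 / Λ) * (D * ε₀ + 2 * D * ε₁) + uvMixedConst Λ 0 1 * ε₂) ^ 2 *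
          ((2 / Λ) ^ (2 * 1) * (2 * β / Λ))) := by
  set c := β * (L : ℝ) ^ 2 with hc
  set Kx := uvMixedConst Λ 0 3 * (2 / Λ) ^ 2 * D ^ 2 * ε₀ + uvMixedConst Λ 0 2 * (2 / Λ) * (D * ε₀ + 2 * D * ε₁) + uvMixedConst Λ 0 1 * ε₂
    with hKx
  have hpt : ∀ (q₀ : TorusSite 1 N) (qv : TorusSite 2 L),
      ‖(fwdDiff (Pi.single l (1 : ZMod L) : TorusSite 2 L))^[2]
          (gridSymbol L M N β (fun ks => uvSymbolCT L M β μ K Λ ks - uvSymbolCT L M β μ K' Λ ks) σ q₀) qv‖ ^ 2 ≤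
        if (q₀ 0).val < 2 * M then (1 / c) ^ 4 * c ^ 2 * (2 * Real.pi / L) ^ 4 * Kx ^ 2 * (1 / max |gridFreq M N β q₀| (Λ / 2) ^ (2 * 1 + 2))
        else 0 := by
    intro q₀ qv
    split_ifs with hq
    · have h := norm_fwdDiff_two_space_gridSymbol_sub_le (μ := μ) (Λ := Λ) (M := M) (N := N) hβ hΛ hD hε₀ hε₁ hline hline' hΔ σ q₀ qv l
      have hm := uvEnv_pos hΛ (gridFreq M N β q₀)
      refine (pow_le_pow_left₀ (norm_nonneg _) h 2).trans (le_of_eq ?_)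
      rw [← hc, ← hKx]
      field_simp
    · rw [fwdDiff_two_space_gridSymbol_sub_eq hβ, if_neg hq, norm_zero, zero_pow two_ne_zero]
  refine (sum_le_sum fun q₀ _ => sum_le_sum fun qv _ => hpt q₀ qv).trans ?_
  rw [sum_sum_window_eq hMN β (fun ω => (1 / c) ^ 4 * c ^ 2 * (2 * Real.pi / L) ^ 4 * Kx ^ 2 * (1 / max |ω| (Λ / 2) ^ (2 * 1 + 2))),
    ← mul_sum]
  exact mul_le_mul_of_nonneg_left (mul_le_mul_of_nonneg_left (sum_inv_uvEnv_pow_le hβ hΛ M 1) (by positivity)) (by positivity)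

end Symbol

end Literature.MathematicalPhysics.QuantumLattice

end
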